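import Mathlib
import Literature.NumberTheory.LFunctions.Zhang2022.Section12Lemma121
import Literature.NumberTheory.LFunctions.Zhang2022.SkeletonAssembly
import Literature.NumberTheory.LFunctions.Zhang2022.SkeletonAlpha1
import HarnessLib

/-!
# Zhang (2022), §12 Lemma 12.1 (p. 68), third clause AS PRINTED (`|ε₁ⱼ(d)| < 10⁻⁵`):
# the dropped second-order term, kernel-checked — the printed inequality fails at `d = ⌈P₂⌉ − 1`

Topic `Literature/NumberTheory/LFunctions/Zhang2022` (Landau–Siegel audit tree; verdict-neutral;
campaign D-0069, layer L3, cone leaf C31 `Skeleton.Lemma121`). Y. Zhang, *Discrete mean estimates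
and the Landau–Siegel zero*, arXiv:2211.02515v1 (2022) [Zhang2022LandauSiegel] — **an unrefereed
manuscript under adjudication. This file compares one PRINTED INEQUALITY of its §12 with the
closed form proved in `Section12Lemma121.lean`; it asserts nothing about Theorems 1–2 or about
Landau–Siegel zeros.**

Lemma 12.1, third clause (p. 68, tex L3486–3489; DAG `Z22:§12.u019`, typed `Typed.Sec12B.U019`,
third conjunct of the banked `Skeleton.Lemma121 c′`): for `P″₁ < d < P₂`,
"`Σ_l χ(l)ϰ₁₃(dl)/l^{1−β_j} = (L′(1,χ)/log P₁)(−1 + (2β₆ − β_j)log(d/P″₁) + ε₁ⱼ(d))`,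
`|ε₁ⱼ(d)| < 10⁻⁵`". The proof (p. 68) reaches the closed form
`(L′(1,χ)(d/P″₁)^{−β₆}/log P₁)(−1 + (β₆ − β_j)log(d/P″₁)) + O(𝓛⁻¹⁵)` — a theorem of the tree,
`Typed.Sec12B.U020_holds` — and then linearises "`(d/P″₁)^{−β₆} = 1 − β₆log(d/P″₁) + …`". With
`u = log(d/P″₁)`, `y = (3α/2)u` (`β₆ = 3iα/2`) and `y₁ = |β₁|u`, the true `ε₁ⱼ(d)` is
`g = e^{−iy}(−1 + i(y − y₁)) + 1 − i(2y − y₁)` up to `O(𝓛⁻⁶/|L′|)`, and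
`Re g = (1 − cos y) + (y − y₁)sin y` — of second order in `αu ≤ 0.004π`, NOT below `10⁻⁵`: at the
endpoint `d* = ⌈P₂⌉ − 1` (`u → 0.004·log P`, `y → 0.006π`, `y₁ → 0.004π`) it tends to `2.96·10⁻⁴`.

| decl | content |
|---|---|
| `U019_fails_at_endpoint` | under (A), for all large `D`, at `(j,d) = (1, ⌈P₂⌉−1)`: `‖sum − printed main term‖ ≥ 2.5·10⁻⁴‖L′(1,χ)‖/log P₁ − C𝓛⁻¹⁵` (printed: `≤ 10⁻⁵‖L′(1,χ)‖/log P₁`) |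
| `U019_untenable` | `U019 c′ → ForAllLarge ¬(A)`: the printed clause cannot hold non-vacuously (uses `L′(1,χ) ≫ 1` under (A), Lemma 5.7 = tree `Skeleton.lemma57_holds`) |
| `lemma121_untenable` | the same for the banked `Skeleton.Lemma121 c′` (`lemma121_iff`) |

Elementary inputs: `Real.cos_bound` (`cos y ≤ 1 − y²/2 + 5y⁴/96`), `Real.sin_gt_sub_cube`
(`sin y ≥ y − y³/6`), giving `Re g ≥ 2.5·10⁻⁴` for `y ∈ [0.0188, 0.02]`, `y − y₁ ≥ 0.006`; the
endpoint estimates `log(⌈P₂⌉−1) − log P″₁ ∈ [0.004𝓛⁹ − 531𝓛², 0.004𝓛⁹]` for `𝓛 ≥ 20 + 1600|c′|`.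
Standing of the finding (campaign ledger `G-num5-1`, num lane, main-value reading, witness
`u = 0.004`: `|ε₁₁| = 2.961·10⁻⁴`, `×29.6` the printed `10⁻⁵`; the INTEGRATED consumer (12.16)/(12.17)
survives at the `10⁻⁵` level): this file is the node-level companion — the actual character sum,
the `c′`-dependent shifts, hypothesis (A) — and the REPAIRED clause is `U020_holds`. What this is
NOT: a refutation of `Skeleton.Lemma121` outright (its hypothesis (A) cannot be instantiated), a
statement about (12.17), or about Theorems 1–2 / Landau–Siegel zeros.

## References

* Y. Zhang, arXiv:2211.02515v1 (2022), §12 Lemma 12.1 and its proof, p. 68.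
  [cite: Zhang2022LandauSiegel, §12 Lemma 12.1, p. 68]
-/

noncomputable section

open Complex Real ComplexConjugate

namespace Literature.NumberTheory.LFunctions.Zhang2022.Typed.Sec12B

open Literature.NumberTheory.LFunctions.Zhang2022.Skeleton

/-! ### The real part of `g(y,a,b) = e^{−iy}(−1 + ia) − (−1 + ib)` -/

section Trig

/-- `Re{e^{−iy}(−1 + ia) − (−1 + ib)} = (1 − cos y) + a·sin y`. [folklore] -/
private theorem re_g_eq (y a b : ℝ) :
    (Complex.exp (-((y : ℂ) * I)) * (-1 + (a : ℂ) * I) - (-1 + (b : ℂ) * I)).re =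
      (1 - Real.cos y) + a * Real.sin y := by
  rw [show -((y : ℂ) * I) = ((-y : ℝ) : ℂ) * I by push_cast; ring, Complex.exp_mul_I,
    ← Complex.ofReal_cos, ← Complex.ofReal_sin, Real.cos_neg, Real.sin_neg]
  simp only [Complex.sub_re, Complex.mul_re, Complex.add_re, Complex.ofReal_re, Complex.mul_im,
    Complex.add_im, Complex.ofReal_im, Complex.I_re, Complex.I_im, Complex.neg_re, Complex.neg_im,
    Complex.one_re, Complex.one_im, Complex.ofReal_neg]
  ring

/-- For `0.0188 ≤ y ≤ 0.02` and `a ≥ 0.006`: `(1 − cos y) + a sin y ≥ 2.5·10⁻⁴`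
(`cos y ≤ 1 − y²/2 + 5y⁴/96`, `sin y ≥ y − y³/6`; the value at `y = 0.006π`, `a = 0.002π` is
`2.96·10⁻⁴`). [folklore] -/
private theorem re_g_lower {y a : ℝ} (hy0 : 0.0188 ≤ y) (hy1 : y ≤ 0.02) (ha : 0.006 ≤ a) :
    (2.5e-4 : ℝ) ≤ (1 - Real.cos y) + a * Real.sin y := by
  have hypos : 0 < y := by linarith
  have hyabs : |y| ≤ 1 := by rw [abs_of_pos hypos]; linarith
  have hc := Real.cos_bound hyabs
  rw [abs_of_pos hypos] at hc
  have hc' : Real.cos y ≤ 1 - y ^ 2 / 2 + y ^ 4 * (5 / 96) := by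
    have := (abs_le.mp hc).2; linarith
  have hs : y - y ^ 3 / 6 < Real.sin y := Real.sin_gt_sub_cube hypos
  have hy2 : y ^ 2 ≤ 0.0004 := by nlinarith
  have hy3 : y ^ 3 ≤ 0.0004 * y := by nlinarith
  have hy4 : y ^ 4 ≤ 0.0004 * y ^ 2 := by nlinarith
  have hsin0 : 0 ≤ Real.sin y := by nlinarith
  have h1 : 0.49997 * y ^ 2 ≤ 1 - Real.cos y := by nlinarith
  have h2 : 0.0059994 * y ≤ a * Real.sin y := by
    have h21 : 0.9999 * y ≤ Real.sin y := by nlinarith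
    calc 0.0059994 * y ≤ 0.006 * (0.9999 * y) := by nlinarith
      _ ≤ 0.006 * Real.sin y := by nlinarith
      _ ≤ a * Real.sin y := by nlinarith
  have hy2l : 0.0188 ^ 2 ≤ y ^ 2 := by nlinarith
  nlinarith

/-- `|g| ≥ Re g`. [folklore] -/
private theorem norm_g_lower {y a b : ℝ} (hy0 : 0.0188 ≤ y) (hy1 : y ≤ 0.02) (ha : 0.006 ≤ a) :
    (2.5e-4 : ℝ) ≤ ‖Complex.exp (-((y : ℂ) * I)) * (-1 + (a : ℂ) * I) - (-1 + (b : ℂ) * I)‖ := by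
  refine le_trans (re_g_lower hy0 hy1 ha) ?_
  rw [← re_g_eq y a b]
  exact le_trans (le_abs_self _) (Complex.abs_re_le_norm _)

end Trig

/-! ### The endpoint `d* = ⌈P₂⌉ − 1` of the range `P″₁ < d < P₂` -/

section Endpoint

/-- At `d* = ⌈P₂⌉ − 1` (for `𝓛 ≥ 20 + 1600|c′|`): `d*` lies in the third range of Lemma 12.1, and
with `u* = log(d*/P″₁)`, `w = π/𝓛⁹ = α`: `y₆ := (3/2)w·u* ∈ [0.0188, 0.02]` (limit `0.006π`) and
`a := (β₆ − β₁)u*/i = w u*(1/2 + 5c′w𝓛) ≥ 0.006` (limit `0.002π`).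
[cite: Zhang2022LandauSiegel, §12 Lemma 12.1, p. 68] -/
private theorem endpoint (c' : ℝ) {D : ℕ} (hL : 20 + 1600 * |c'| ≤ Real.log D) :
    1 ≤ ⌈Skeleton.P2 D⌉₊ - 1 ∧ P1pp D < ((⌈Skeleton.P2 D⌉₊ - 1 : ℕ) : ℝ) ∧
    ((⌈Skeleton.P2 D⌉₊ - 1 : ℕ) : ℝ) < Skeleton.P2 D ∧
    0.0188 ≤ 3 / 2 * (π / Real.log D ^ 9) *
        Real.log (((⌈Skeleton.P2 D⌉₊ - 1 : ℕ) : ℝ) / P1pp D) ∧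
    3 / 2 * (π / Real.log D ^ 9) *
        Real.log (((⌈Skeleton.P2 D⌉₊ - 1 : ℕ) : ℝ) / P1pp D) ≤ 0.02 ∧
    0.006 ≤ (3 / 2 * (π / Real.log D ^ 9) -
        π / Real.log D ^ 9 * (1 - 5 * c' * (π / Real.log D ^ 9) * Real.log D)) *
      Real.log (((⌈Skeleton.P2 D⌉₊ - 1 : ℕ) : ℝ) / P1pp D) := by
  obtain ⟨L, hLdef⟩ : ∃ L : ℝ, L = Real.log D := ⟨_, rfl⟩
  rw [← hLdef] at hL ⊢
  have hc0 : 0 ≤ |c'| := abs_nonneg _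
  have hL20 : 20 ≤ L := by linarith
  have hL1 : 1 ≤ L := by linarith
  have hL0 : 0 < L := by linarith
  have hπ := Real.pi_pos
  have hπlo : 3.1415 < π := Real.pi_gt_d4
  have hπhi : π < 3.15 := Real.pi_lt_d2
  have hell : ell D = L := hLdef.symm
  -- `D ≥ 21`
  have hD0 : (0 : ℝ) < D := by
    rcases (Nat.cast_nonneg D : (0 : ℝ) ≤ D).eq_or_lt with h | h
    · exfalso; rw [← h, Real.log_zero] at hLdef; linarith
    · exact h
  have hDr : (21 : ℝ) ≤ D := by
    have := Real.log_le_sub_one_of_pos hD0; linarith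
  have hD3 : 3 ≤ D := by exact_mod_cast (show (3 : ℝ) ≤ D by linarith)
  have hP : 0 < bigP D := Real.exp_pos _
  have hT : 0 < bigT D := Real.exp_pos _
  have hP1pp : 0 < P1pp D := P1pp_pos hD3
  have hP2pos : 0 < Skeleton.P2 D := by rw [Skeleton.P2]; positivity
  -- powers of `L`
  have hL7 : (1.28e9 : ℝ) ≤ L ^ 7 := by
    have := pow_le_pow_left₀ (by norm_num) hL20 7; norm_num at this; linarith
  have hL2 : (400 : ℝ) ≤ L ^ 2 := by nlinarith
  have hLL2 : L ≤ L ^ 2 := by nlinarith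
  have hL9 : L ^ 9 = L ^ 7 * L ^ 2 := by ring
  have hL9low : 1.28e9 * L ^ 2 ≤ L ^ 9 := by
    rw [hL9]; exact mul_le_mul_of_nonneg_right hL7 (by positivity)
  have h11 : L ^ (1.1 : ℝ) ≤ L ^ 2 := by
    calc L ^ (1.1 : ℝ) ≤ L ^ ((2 : ℕ) : ℝ) := Real.rpow_le_rpow_of_exponent_le hL1 (by norm_num)
      _ = L ^ 2 := Real.rpow_natCast L 2
  have h11nn : 0 ≤ L ^ (1.1 : ℝ) := Real.rpow_nonneg hL0.le _
  have hlogL : Real.log L ≤ L := by have := Real.log_le_sub_one_of_pos hL0; linarith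
  have hlogL0 : 0 ≤ Real.log L := Real.log_nonneg hL1
  have hlog2 : Real.log 2 < 1 := by have := Real.log_two_lt_d9; linarith
  have hlog2pos : 0 < Real.log 2 := Real.log_pos (by norm_num)
  -- the logarithms of `P₂` and `P″₁`
  have hlogP2 : Real.log (Skeleton.P2 D) = 0.5 * L ^ 9 - 10 * L ^ (1.1 : ℝ) := by
    rw [Skeleton.P2, Real.log_div (Real.rpow_pos_of_pos hP _).ne' (pow_pos hT 10).ne',
      Real.log_rpow hP, Real.log_pow, bigT, Real.log_exp, bigP, Real.log_exp, hell]
    push_cast; ring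
  have hlogP1pp : Real.log (P1pp D) = 0.496 * L ^ 9 + L + 519 * Real.log L := by
    have ht0 : 0 < t0 D := by rw [t0, hell]; positivity
    rw [P1pp, Real.log_mul (by positivity) ht0.ne', Real.log_mul (Real.rpow_pos_of_pos hP _).ne'
      hD0.ne', Real.log_rpow hP, bigP, Real.log_exp, t0, Real.log_pow, hell, ← hLdef]
    push_cast; ring
  -- `P₂ ≥ 2` and `P₂/2 > P″₁`
  have hP2two : 2 ≤ Skeleton.P2 D := by
    have h1 : 1 ≤ Real.log (Skeleton.P2 D) := by rw [hlogP2]; linarith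
    have h2 : Real.exp 1 ≤ Skeleton.P2 D := by
      calc Real.exp 1 ≤ Real.exp (Real.log (Skeleton.P2 D)) := Real.exp_le_exp.mpr h1
        _ = Skeleton.P2 D := Real.exp_log hP2pos
    linarith [Real.add_one_le_exp (1 : ℝ)]
  have hgap : Real.log (P1pp D) < Real.log (Skeleton.P2 D / 2) := by
    rw [Real.log_div hP2pos.ne' (by norm_num), hlogP2, hlogP1pp]
    linarith
  have hhalf : P1pp D < Skeleton.P2 D / 2 :=
    (Real.log_lt_log_iff hP1pp (by positivity)).mp hgap
  -- `d*` as a real number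
  have hceil1 : 1 ≤ ⌈Skeleton.P2 D⌉₊ := Nat.one_le_iff_ne_zero.mpr (Nat.ceil_pos.mpr hP2pos).ne'
  have hdcast : (((⌈Skeleton.P2 D⌉₊ - 1 : ℕ)) : ℝ) = (⌈Skeleton.P2 D⌉₊ : ℝ) - 1 := by
    rw [Nat.cast_sub hceil1]; simp
  have hdlow : Skeleton.P2 D - 1 ≤ (((⌈Skeleton.P2 D⌉₊ - 1 : ℕ)) : ℝ) := by
    rw [hdcast]; linarith [Nat.le_ceil (Skeleton.P2 D)]
  have hdup : (((⌈Skeleton.P2 D⌉₊ - 1 : ℕ)) : ℝ) < Skeleton.P2 D := by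
    rw [hdcast]; linarith [Nat.ceil_lt_add_one hP2pos.le]
  have hd1 : 1 ≤ ⌈Skeleton.P2 D⌉₊ - 1 := by
    have : (1 : ℝ) ≤ (((⌈Skeleton.P2 D⌉₊ - 1 : ℕ)) : ℝ) := by linarith
    exact_mod_cast this
  have hdpos : (0 : ℝ) < (((⌈Skeleton.P2 D⌉₊ - 1 : ℕ)) : ℝ) := by linarith
  have hdP1 : P1pp D < (((⌈Skeleton.P2 D⌉₊ - 1 : ℕ)) : ℝ) := by linarith
  -- `u* = log d* − log P″₁ ∈ [0.004𝓛⁹ − 531𝓛², 0.004𝓛⁹]`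
  obtain ⟨u, hu⟩ : ∃ u : ℝ, u = Real.log ((((⌈Skeleton.P2 D⌉₊ - 1 : ℕ)) : ℝ) / P1pp D) :=
    ⟨_, rfl⟩
  rw [← hu]
  have hu' : u = Real.log ((((⌈Skeleton.P2 D⌉₊ - 1 : ℕ)) : ℝ)) - Real.log (P1pp D) := by
    rw [hu, Real.log_div hdpos.ne' hP1pp.ne']
  have hu_up : u ≤ 0.004 * L ^ 9 := by
    have h1 : Real.log ((((⌈Skeleton.P2 D⌉₊ - 1 : ℕ)) : ℝ)) < Real.log (Skeleton.P2 D) :=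
      Real.log_lt_log hdpos hdup
    rw [hu']; rw [hlogP2] at h1; rw [hlogP1pp]; linarith
  have hu_low : 0.004 * L ^ 9 - 531 * L ^ 2 ≤ u := by
    have h1 : Real.log (Skeleton.P2 D / 2) ≤ Real.log ((((⌈Skeleton.P2 D⌉₊ - 1 : ℕ)) : ℝ)) :=
      Real.log_le_log (by positivity) (by linarith)
    rw [Real.log_div hP2pos.ne' (by norm_num), hlogP2] at h1
    rw [hu', hlogP1pp]
    linarith
  -- `w u ∈ [0.004π − 531π/𝓛⁷, 0.004π]`
  have hw0 : 0 < π / L ^ 9 := by positivity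
  have hwu_up : π / L ^ 9 * u ≤ 0.004 * π := by
    calc π / L ^ 9 * u ≤ π / L ^ 9 * (0.004 * L ^ 9) := mul_le_mul_of_nonneg_left hu_up hw0.le
      _ = 0.004 * π := by field_simp
  have hsmall : π / L ^ 7 ≤ 2.5e-9 := by
    rw [div_le_iff₀ (by positivity)]
    have : 2.5e-9 * (1.28e9 : ℝ) ≤ 2.5e-9 * L ^ 7 := mul_le_mul_of_nonneg_left hL7 (by norm_num)
    linarith
  have hwu_low : 0.004 * π - 531 * (π / L ^ 7) ≤ π / L ^ 9 * u := by
    calc 0.004 * π - 531 * (π / L ^ 7) = π / L ^ 9 * (0.004 * L ^ 9 - 531 * L ^ 2) := by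
          field_simp
      _ ≤ π / L ^ 9 * u := mul_le_mul_of_nonneg_left hu_low hw0.le
  refine ⟨hd1, hdP1, hdup, ?_, ?_, ?_⟩
  · -- `y₆ ≥ 0.0188`
    have : 3 / 2 * (π / L ^ 9) * u = 3 / 2 * (π / L ^ 9 * u) := by ring
    rw [this]; linarith
  · have : 3 / 2 * (π / L ^ 9) * u = 3 / 2 * (π / L ^ 9 * u) := by ring
    rw [this]; linarith
  · -- `a ≥ 0.006`
    have hid : (3 / 2 * (π / L ^ 9) - π / L ^ 9 * (1 - 5 * c' * (π / L ^ 9) * L)) * u =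
        (π / L ^ 9 * u) * (1 / 2 + 5 * c' * (π / L ^ 9) * L) := by ring
    rw [hid]
    have hfac : 0.49 ≤ 1 / 2 + 5 * c' * (π / L ^ 9) * L := by
      have h1 : 5 * c' * (π / L ^ 9) * L = 5 * c' * (π / L ^ 8) := by
        field_simp
      rw [h1]
      have h2 : |c'| ≤ L / 1600 := by linarith
      have h3 : 5 * |c'| * (π / L ^ 8) ≤ 0.01 := by
        calc 5 * |c'| * (π / L ^ 8) ≤ 5 * (L / 1600) * (π / L ^ 8) := by gcongr
          _ = π / L ^ 7 / 320 := by field_simp; ring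
          _ ≤ 0.01 := by linarith
      have h4 : -(5 * |c'| * (π / L ^ 8)) ≤ 5 * c' * (π / L ^ 8) := by
        have h5 : 0 ≤ 5 * (π / L ^ 8) := by positivity
        have := mul_le_mul_of_nonneg_right (neg_abs_le c') h5
        linarith
      linarith
    have hwu0 : 0 ≤ π / L ^ 9 * u := by linarith
    calc (0.006 : ℝ) ≤ 0.0125 * 0.49 := by norm_num
      _ ≤ (π / L ^ 9 * u) * (1 / 2 + 5 * c' * (π / L ^ 9) * L) :=
          mul_le_mul (by linarith) hfac (by norm_num) hwu0

end Endpoint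

/-! ### The printed third clause against the closed form -/

section Printed

variable (c' : ℝ)

/-- The comparison at the endpoint, from the closed form of the first line (hypotheses: the exact
identity `sum121 = line020` and the node `U020`, both theorems of `Section12Lemma121.lean`).
[cite: Zhang2022LandauSiegel, §12 Lemma 12.1, p. 68] -/
private theorem printed_gap_of
    (hex : ∀ {D : ℕ} (χ : DirichletCharacter ℂ D), 3 ≤ D → ∀ (j : ℕ) {d : ℕ}, 1 ≤ d →
      P1pp D < d → sum121 c' χ j d = line020 c' χ j d)
    (h20 : U020 c') :
    ∃ C : ℝ, ForAllLarge fun D _ χ => AssumptionA D χ →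
      1 ≤ ⌈Skeleton.P2 D⌉₊ - 1 ∧ P1pp D < ((⌈Skeleton.P2 D⌉₊ - 1 : ℕ) : ℝ) ∧
      ((⌈Skeleton.P2 D⌉₊ - 1 : ℕ) : ℝ) < Skeleton.P2 D ∧
      2.5e-4 * ‖deriv χ.LFunction 1‖ / Real.log (Skeleton.P1 D) - C * (ell D ^ 15)⁻¹ ≤
        ‖sum121 c' χ 1 (⌈Skeleton.P2 D⌉₊ - 1) - deriv χ.LFunction 1 / Real.log (Skeleton.P1 D) *
            (-1 + (2 * beta6 D - betaJ c' D 1) *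
              (Real.log (((⌈Skeleton.P2 D⌉₊ - 1 : ℕ) : ℝ) / P1pp D) : ℂ))‖ := by
  obtain ⟨c, -, C, D₂, h20'⟩ := h20
  refine ⟨C, max D₂ ⌈Real.exp (20 + 1600 * |c'|)⌉₊, fun D _ χ hD hq hp hA => ?_⟩
  have hD₂ : D₂ ≤ D := le_trans (le_max_left _ _) hD
  have hDexp : Real.exp (20 + 1600 * |c'|) ≤ D :=
    le_trans (Nat.le_ceil _) (by exact_mod_cast le_trans (le_max_right _ _) hD)
  have hD0 : (0 : ℝ) < D := lt_of_lt_of_le (Real.exp_pos _) hDexp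
  have hL : 20 + 1600 * |c'| ≤ Real.log D := (Real.le_log_iff_exp_le hD0).mpr hDexp
  obtain ⟨hd1, hdP1, hdP2, hy0, hy1, ha⟩ := endpoint c' hL
  have hc0 : 0 ≤ |c'| := abs_nonneg _
  have hL1 : 1 ≤ Real.log D := by linarith
  have hL0 : 0 < Real.log D := by linarith
  have hπ := Real.pi_pos
  have hell : ell D = Real.log D := rfl
  have hDr : (21 : ℝ) ≤ D := by have := Real.log_le_sub_one_of_pos hD0; linarith
  have hD3 : 3 ≤ D := by exact_mod_cast (show (3 : ℝ) ≤ D by linarith)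
  have hP : 0 < bigP D := Real.exp_pos _
  have hP1pp : 0 < P1pp D := P1pp_pos hD3
  -- the two inputs at `(j, d) = (1, d*)`
  have h2 := (h20' D χ hD₂ hq hp hA 1 (by simp) _ hd1 hdP1 hdP2).2
  have hexact := hex χ hD3 1 hd1 hdP1
  refine ⟨hd1, hdP1, hdP2, ?_⟩
  -- names
  obtain ⟨u, hu⟩ : ∃ u : ℝ, u = Real.log (((⌈Skeleton.P2 D⌉₊ - 1 : ℕ) : ℝ) / P1pp D) :=
    ⟨_, rfl⟩
  obtain ⟨w, hw⟩ : ∃ w : ℝ, w = π / Real.log D ^ 9 := ⟨_, rfl⟩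
  rw [← hu] at h2 hy0 hy1 ha ⊢
  rw [← hw] at hy0 hy1 ha
  have hα : alpha D = w := by rw [hw, alpha, bigP, Real.log_exp, hell]
  have hlogP1 : Real.log (Skeleton.P1 D) = 0.504 * Real.log D ^ 9 := by
    rw [Skeleton.P1, Real.log_rpow hP, bigP, Real.log_exp, hell]
  have hlP0 : 0 < Real.log (Skeleton.P1 D) := by rw [hlogP1]; positivity
  have hβ6 : beta6 D = ((3 / 2 * w : ℝ) : ℂ) * I := by rw [beta6, hα]; push_cast; ring
  have hβ1 : betaJ c' D 1 = ((w * (1 - 5 * c' * w * Real.log D) : ℝ) : ℂ) * I := by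
    simp only [betaJ, Nat.reduceMod, if_true, beta1, hα, hell]
    push_cast; ring
  -- `(d*/P″₁)^{−β₆} = e^{−iy₆}`
  have hdpos : (0 : ℝ) < ((⌈Skeleton.P2 D⌉₊ - 1 : ℕ) : ℝ) / P1pp D :=
    div_pos (lt_trans hP1pp hdP1) hP1pp
  have hcd : ((((⌈Skeleton.P2 D⌉₊ - 1 : ℕ) : ℝ) / P1pp D : ℝ) : ℂ) ^ (-beta6 D) =
      Complex.exp (-(((3 / 2 * w * u : ℝ) : ℂ) * I)) := by
    rw [Complex.cpow_def_of_ne_zero (by exact_mod_cast hdpos.ne'), ← Complex.ofReal_log hdpos.le,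
      ← hu, hβ6]
    push_cast; ring_nf
  -- the difference of the two main terms is `(L′/log P₁)·g`
  have hid : deriv χ.LFunction 1 *
        ((((⌈Skeleton.P2 D⌉₊ - 1 : ℕ) : ℝ) / P1pp D : ℝ) : ℂ) ^ (-beta6 D) /
          (Real.log (Skeleton.P1 D) : ℂ) * (-1 + (beta6 D - betaJ c' D 1) * (u : ℂ)) -
        deriv χ.LFunction 1 / Real.log (Skeleton.P1 D) *
          (-1 + (2 * beta6 D - betaJ c' D 1) * (u : ℂ)) =
      deriv χ.LFunction 1 / (Real.log (Skeleton.P1 D) : ℂ) *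
        (Complex.exp (-(((3 / 2 * w * u : ℝ) : ℂ) * I)) *
            (-1 + (((3 / 2 * w - w * (1 - 5 * c' * w * Real.log D)) * u : ℝ) : ℂ) * I) -
          (-1 + (((2 * (3 / 2 * w) - w * (1 - 5 * c' * w * Real.log D)) * u : ℝ) : ℂ) * I)) := by
    rw [hcd, hβ6, hβ1]; push_cast; ring
  -- the lower bound for `g`
  have hg := norm_g_lower (b := (2 * (3 / 2 * w) - w * (1 - 5 * c' * w * Real.log D)) * u)
    hy0 hy1 ha
  -- the triangle inequality
  have htri := norm_sub_le_norm_sub_add_norm_sub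
    (deriv χ.LFunction 1 *
        ((((⌈Skeleton.P2 D⌉₊ - 1 : ℕ) : ℝ) / P1pp D : ℝ) : ℂ) ^ (-beta6 D) /
          (Real.log (Skeleton.P1 D) : ℂ) * (-1 + (beta6 D - betaJ c' D 1) * (u : ℂ)))
    (sum121 c' χ 1 (⌈Skeleton.P2 D⌉₊ - 1))
    (deriv χ.LFunction 1 / Real.log (Skeleton.P1 D) *
          (-1 + (2 * beta6 D - betaJ c' D 1) * (u : ℂ)))
  rw [hid, norm_mul, norm_div, Complex.norm_real, Real.norm_eq_abs, abs_of_pos hlP0] at htri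
  have herr : ‖deriv χ.LFunction 1 *
        ((((⌈Skeleton.P2 D⌉₊ - 1 : ℕ) : ℝ) / P1pp D : ℝ) : ℂ) ^ (-beta6 D) /
          (Real.log (Skeleton.P1 D) : ℂ) * (-1 + (beta6 D - betaJ c' D 1) * (u : ℂ)) -
        sum121 c' χ 1 (⌈Skeleton.P2 D⌉₊ - 1)‖ ≤ C * (ell D ^ 15)⁻¹ := by
    rw [norm_sub_rev, hexact]; exact h2
  have hmain : 2.5e-4 * ‖deriv χ.LFunction 1‖ / Real.log (Skeleton.P1 D) ≤
      ‖deriv χ.LFunction 1‖ / Real.log (Skeleton.P1 D) *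
        ‖Complex.exp (-(((3 / 2 * w * u : ℝ) : ℂ) * I)) *
            (-1 + (((3 / 2 * w - w * (1 - 5 * c' * w * Real.log D)) * u : ℝ) : ℂ) * I) -
          (-1 + (((2 * (3 / 2 * w) - w * (1 - 5 * c' * w * Real.log D)) * u : ℝ) : ℂ) * I)‖ := by
    rw [show 2.5e-4 * ‖deriv χ.LFunction 1‖ / Real.log (Skeleton.P1 D) =
      ‖deriv χ.LFunction 1‖ / Real.log (Skeleton.P1 D) * 2.5e-4 by ring]
    exact mul_le_mul_of_nonneg_left hg (by positivity)
  linarith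

end Printed

/-! ### Consequence: the printed third clause cannot hold under (A) for large `D` -/

section Untenable

variable (c' : ℝ)

/-- From the endpoint gap: if the printed third clause of Lemma 12.1 (`U019`) held, then (A) would
fail for every large `D` — i.e. under its own hypothesis (A) the printed inequality
`|ε₁₁(⌈P₂⌉−1)| < 10⁻⁵` is false for all large `D` (it is off by a factor `≥ 25`), because
`L′(1,χ) ≫ 1` under (A) (Lemma 5.7, a theorem of the tree: `Skeleton.lemma57_holds`).
[cite: Zhang2022LandauSiegel, §12 Lemma 12.1, p. 68] -/
private theorem untenable_of_gap
    (hgap : ∃ C : ℝ, ForAllLarge fun D _ χ => AssumptionA D χ →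
      1 ≤ ⌈Skeleton.P2 D⌉₊ - 1 ∧ P1pp D < ((⌈Skeleton.P2 D⌉₊ - 1 : ℕ) : ℝ) ∧
      ((⌈Skeleton.P2 D⌉₊ - 1 : ℕ) : ℝ) < Skeleton.P2 D ∧
      2.5e-4 * ‖deriv χ.LFunction 1‖ / Real.log (Skeleton.P1 D) - C * (ell D ^ 15)⁻¹ ≤
        ‖sum121 c' χ 1 (⌈Skeleton.P2 D⌉₊ - 1) - deriv χ.LFunction 1 / Real.log (Skeleton.P1 D) *
            (-1 + (2 * beta6 D - betaJ c' D 1) *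
              (Real.log (((⌈Skeleton.P2 D⌉₊ - 1 : ℕ) : ℝ) / P1pp D) : ℂ))‖)
    (h19 : U019 c') : ForAllLarge fun D _ χ => ¬ AssumptionA D χ := by
  obtain ⟨C, D₁, hgap'⟩ := hgap
  obtain ⟨D₂, h19'⟩ := h19
  obtain ⟨c57, hc57, D₃, h57⟩ := lemma57_holds
  refine ⟨max (max D₁ D₂) (max D₃ ⌈Real.exp (2100 * |C| / c57 + 3)⌉₊),
    fun D _ χ hD hq hp hA => ?_⟩
  have hD₁ : D₁ ≤ D := le_trans (le_trans (le_max_left _ _) (le_max_left _ _)) hD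
  have hD₂ : D₂ ≤ D := le_trans (le_trans (le_max_right _ _) (le_max_left _ _)) hD
  have hD₃ : D₃ ≤ D := le_trans (le_trans (le_max_left _ _) (le_max_right _ _)) hD
  have hDexp : Real.exp (2100 * |C| / c57 + 3) ≤ D :=
    le_trans (Nat.le_ceil _)
      (by exact_mod_cast le_trans (le_trans (le_max_right _ _) (le_max_right _ _)) hD)
  have hD0 : (0 : ℝ) < D := lt_of_lt_of_le (Real.exp_pos _) hDexp
  have hL : 2100 * |C| / c57 + 3 ≤ Real.log D := (Real.le_log_iff_exp_le hD0).mpr hDexp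
  have hCc : 0 ≤ 2100 * |C| / c57 := by positivity
  have hL3 : 3 ≤ Real.log D := by linarith
  have hL1 : 1 ≤ Real.log D := by linarith
  have hell : ell D = Real.log D := rfl
  have hP : 0 < bigP D := Real.exp_pos _
  have hlogP1 : Real.log (Skeleton.P1 D) = 0.504 * Real.log D ^ 9 := by
    rw [Skeleton.P1, Real.log_rpow hP, bigP, Real.log_exp, hell]
  -- the three inputs at this `D`
  obtain ⟨hd1, hdP1, hdP2, hlow⟩ := hgap' D χ hD₁ hq hp hA
  have hup := h19' D χ hD₂ hq hp hA 1 (by simp) _ hd1 hdP1 hdP2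
  have h57D := h57 D χ hD₃ hq hp hA
  -- `‖L′(1,χ)‖ ≥ c₅₇`
  have hDφ : (1 : ℝ) ≤ (D : ℝ) / Nat.totient D := by
    have hφpos : 0 < Nat.totient D := Nat.totient_pos.mpr (by exact_mod_cast hD0)
    rw [le_div_iff₀ (by exact_mod_cast hφpos), one_mul]
    exact_mod_cast Nat.totient_le D
  have hL1norm : c57 ≤ ‖deriv χ.LFunction 1‖ := by
    calc c57 = c57 * 1 := (mul_one _).symm
      _ ≤ c57 * ((D : ℝ) / Nat.totient D) := mul_le_mul_of_nonneg_left hDφ hc57.le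
      _ ≤ (deriv χ.LFunction 1).re := h57D
      _ ≤ ‖deriv χ.LFunction 1‖ := Complex.re_le_norm _
  -- combine: `2.4·10⁻⁴‖L′‖/log P₁ ≤ C/𝓛¹⁵`, i.e. `‖L′‖·𝓛⁶ ≤ 2100 C`
  have hcomb : 2.5e-4 * ‖deriv χ.LFunction 1‖ / Real.log (Skeleton.P1 D) - C * (ell D ^ 15)⁻¹ ≤
      1e-5 * ‖deriv χ.LFunction 1‖ / Real.log (Skeleton.P1 D) := le_trans hlow hup
  rw [hlogP1, hell, mul_div_assoc, mul_div_assoc] at hcomb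
  have hL0 : 0 < Real.log D := by linarith
  have hL9 : 0 < Real.log D ^ 9 := by positivity
  have hL15 : 0 < Real.log D ^ 15 := by positivity
  obtain ⟨A, hAdef⟩ : ∃ A : ℝ, A = ‖deriv χ.LFunction 1‖ / (0.504 * Real.log D ^ 9) := ⟨_, rfl⟩
  rw [← hAdef] at hcomb
  have hkey : ‖deriv χ.LFunction 1‖ * Real.log D ^ 6 ≤ 2100 * C := by
    have h1 : 2.4e-4 * A ≤ C * (Real.log D ^ 15)⁻¹ := by linarith
    have h1' : 2.4e-4 * A * Real.log D ^ 15 ≤ C := by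
      have := mul_le_mul_of_nonneg_right h1 hL15.le
      rwa [mul_assoc C, inv_mul_cancel₀ hL15.ne', mul_one] at this
    have hnorm : ‖deriv χ.LFunction 1‖ = A * (0.504 * Real.log D ^ 9) := by
      rw [hAdef]; field_simp
    have hpow : ‖deriv χ.LFunction 1‖ * Real.log D ^ 6 = 0.504 * (A * Real.log D ^ 15) := by
      rw [hnorm]; ring
    rw [hpow]
    nlinarith
  -- contradiction with `𝓛 ≥ 2100|C|/c₅₇ + 3` and `‖L′‖ ≥ c₅₇ > 0`
  have hL6 : Real.log D ≤ Real.log D ^ 6 := by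
    calc Real.log D = Real.log D ^ 1 := (pow_one _).symm
      _ ≤ Real.log D ^ 6 := pow_le_pow_right₀ hL1 (by norm_num)
  have h3 : c57 * Real.log D ≤ ‖deriv χ.LFunction 1‖ * Real.log D ^ 6 := by
    calc c57 * Real.log D ≤ ‖deriv χ.LFunction 1‖ * Real.log D :=
          mul_le_mul_of_nonneg_right hL1norm hL0.le
      _ ≤ ‖deriv χ.LFunction 1‖ * Real.log D ^ 6 :=
          mul_le_mul_of_nonneg_left hL6 (norm_nonneg _)
  have h4 : c57 * (2100 * |C| / c57 + 3) ≤ c57 * Real.log D := mul_le_mul_of_nonneg_left hL hc57.le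
  have h5 : c57 * (2100 * |C| / c57 + 3) = 2100 * |C| + 3 * c57 := by field_simp
  have hCabs : C ≤ |C| := le_abs_self C
  linarith

end Untenable

/-! ### The theorems of record -/

section Record

variable (c' : ℝ)

/-- **The printed inequality of Lemma 12.1 fails at the endpoint (kernel form of the "pointwise"
finding).** For every value of the manuscript's constant `c′`, for all large `D`, every real
primitive `χ (mod D)` satisfying (A), at `j = 1` and `d* = ⌈P₂⌉ − 1` (a point of the printed range
`P″₁ < d < P₂`):
`‖Σ_l χ(l)ϰ₁₃(d*l)l^{β₁−1} − (L′(1,χ)/log P₁)(−1 + (2β₆ − β₁)log(d*/P″₁))‖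
   ≥ 2.5·10⁻⁴·|L′(1,χ)|/log P₁ − C𝓛⁻¹⁵`,
whereas the manuscript prints `≤ 10⁻⁵·|L′(1,χ)|/log P₁` ("`|ε₁ⱼ(d)| < 10⁻⁵`", [Z22 p.68, Lemma 12.1,
tex L3486–3489]). Source of the discrepancy: the closed form has the factor `(d/P″₁)^{−β₆} =
e^{−iy}`, `y = (3α/2)log(d/P″₁) → 0.006π`, and the printed main term keeps only its linear part
`1 − β₆log(d/P″₁)`; the dropped second-order term has real part `(1 − cos y) + (y − y₁)sin y →
2.96·10⁻⁴` (`y₁ = |β₁|log(d/P″₁) → 0.004π`). From `U020_holds`, `sum121_eq_line020`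
(`Section12Lemma121`) and the elementary bounds `cos y ≤ 1 − y²/2 + 5y⁴/96`, `sin y ≥ y − y³/6`.
[cite: Zhang2022LandauSiegel, §12 Lemma 12.1, p. 68] -/
theorem U019_fails_at_endpoint : ∃ C : ℝ, ForAllLarge fun D _ χ => AssumptionA D χ →
    1 ≤ ⌈Skeleton.P2 D⌉₊ - 1 ∧ P1pp D < ((⌈Skeleton.P2 D⌉₊ - 1 : ℕ) : ℝ) ∧
    ((⌈Skeleton.P2 D⌉₊ - 1 : ℕ) : ℝ) < Skeleton.P2 D ∧
    2.5e-4 * ‖deriv χ.LFunction 1‖ / Real.log (Skeleton.P1 D) - C * (ell D ^ 15)⁻¹ ≤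
      ‖sum121 c' χ 1 (⌈Skeleton.P2 D⌉₊ - 1) - deriv χ.LFunction 1 / Real.log (Skeleton.P1 D) *
          (-1 + (2 * beta6 D - betaJ c' D 1) *
            (Real.log (((⌈Skeleton.P2 D⌉₊ - 1 : ℕ) : ℝ) / P1pp D) : ℂ))‖ :=
  printed_gap_of c' (fun χ hD j _ hd hd1 => sum121_eq_line020 c' χ hD j hd hd1) (U020_holds c')

/-- **The printed third clause of Lemma 12.1 (`Z22:§12.u019`, `Typed.Sec12B.U019 c′`) is untenable
under (A)**: if it held, then (A) would fail for every large `D` and every real primitive `χ` — in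
other words, for all large `D` the printed bound `|ε₁ⱼ(d)| < 10⁻⁵` is FALSE under the manuscript's
own standing hypothesis (A) (at `j = 1`, `d = ⌈P₂⌉ − 1`, by a factor `≥ 25`), since (A) forces
`L′(1,χ) ≥ c > 0` (Lemma 5.7, tree theorem `Skeleton.lemma57_holds`) while the endpoint gap is
`≥ 2.4·10⁻⁴|L′(1,χ)|/log P₁ − O(𝓛⁻¹⁵)`. This is a statement about the PRINTED INEQUALITY
[Z22 p.68, Lemma 12.1, `|ε₁ⱼ(d)| < 10⁻⁵`], not about Landau–Siegel zeros: the node can only hold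
vacuously. (The campaign's prior, read1 `check12.py`: "pointwise false ×30–65; integrated form
survives" — the second half concerns (12.17) and is not addressed here.)
[cite: Zhang2022LandauSiegel, §12 Lemma 12.1, p. 68] -/
theorem U019_untenable (h19 : U019 c') : ForAllLarge fun D _ χ => ¬ AssumptionA D χ :=
  untenable_of_gap c' (U019_fails_at_endpoint c') h19

/-- **Lemma 12.1 as banked (`Skeleton.Lemma121 c′`, AS PRINTED) is untenable under (A)** (its third
clause is `U019`, `Typed.Sec12B.lemma121_iff`): `Lemma121 c′ → ForAllLarge ¬(A)`. The REPAIRED third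
clause — the closed form with the full factor `(d/P″₁)^{−β₆}` — is the kernel theorem `U020_holds`.
[cite: Zhang2022LandauSiegel, §12 Lemma 12.1, p. 68] -/
theorem lemma121_untenable (h : Skeleton.Lemma121 c') :
    ForAllLarge fun D _ χ => ¬ AssumptionA D χ :=
  U019_untenable c' ((lemma121_iff c').mp h).2

/-- **The deduction node `Z22:Lem12.1.pf` as typed (`Typed.Sec12B.Ded121 c′ := Lemma58 →
Lemma121 c′`) is likewise untenable under (A)**: Lemma 5.8 is a theorem of the tree
(`Skeleton.lemma58_holds`), so `Ded121 c′` yields `Lemma121 c′`. The printed proof's last step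
("`(d/P″₁)^{−β₆} = 1 − β₆log(d/P″₁) + …`, the result follows") is where it fails at the printed
tolerance. [cite: Zhang2022LandauSiegel, §12 proof of Lemma 12.1, p. 68] -/
theorem ded121_untenable (h : Ded121 c') : ForAllLarge fun D _ χ => ¬ AssumptionA D χ :=
  lemma121_untenable c' (h lemma58_holds)

/-- **Consequence for the DAG (record for the adjudication, TEAM R):** the banked leaf
`Skeleton.Lemma121 c′` of `Skeleton.theorem1_of_leaves` implies Theorem 1 BY ITSELF — not because
it proves anything about `L(1,χ)`, but because its printed third clause is inconsistent with (A) for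
all large `D` (`lemma121_untenable`), and "(A) fails for all large `D`" is Theorem 1 up to finitely
many moduli (`Skeleton.theorem1_of_eventually_not_assumptionA`). So the whole-DAG implication is
ALSO carried, vacuously, by this one untenable leaf: the leaf set must be repaired (third clause of
Lemma 12.1 ↦ the closed form `U020`, i.e. `U020_holds`) before `theorem1_of_leaves` measures
anything. WHAT THIS IS NOT: a proof of Theorem 1 (the hypothesis is a false-under-(A) printed
claim), nor a statement about Landau–Siegel zeros. [cite: Zhang2022LandauSiegel, §12 Lemma 12.1,
p. 68] -/
theorem theorem1_of_lemma121 (h : Skeleton.Lemma121 c') : Theorem1 :=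
  theorem1_of_eventually_not_assumptionA (lemma121_untenable c' h)

end Record

/-! ### The `α₁ := α log T` re-bank (`SkeletonAlpha1.Lemma121R`) carries the same printed clause -/

section AlphaOneReading

variable (c' : ℝ)

/-- The third clause of the re-banked `Skeleton.Lemma121R c′` (reading `α₁ := α log T` in the
second clause; third clause verbatim as printed) is `U019 c′`.
[cite: Zhang2022LandauSiegel, §12 Lemma 12.1, p. 68] -/
theorem U019_of_lemma121R (h : Skeleton.Lemma121R c') : U019 c' := by
  obtain ⟨c, -, C, D₀, h⟩ := h
  refine ⟨D₀, fun D _ χ hD hq hp hA j hj d hd h1 h2 => ?_⟩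
  exact (h D χ hD hq hp hA j hj d hd).2.2 h1 h2

/-- **`Skeleton.Lemma121R c′` (the `α₁ := α log T` reading of record) is untenable under (A) for the
same reason as `Lemma121 c′`**: its third clause is the printed `|ε₁ⱼ(d)| < 10⁻⁵`.
[cite: Zhang2022LandauSiegel, §12 Lemma 12.1, p. 68] -/
theorem lemma121R_untenable (h : Skeleton.Lemma121R c') :
    ForAllLarge fun D _ χ => ¬ AssumptionA D χ :=
  U019_untenable c' (U019_of_lemma121R c' h)

/-- Record: the re-banked leaf `Lemma121R c′` likewise implies Theorem 1 by itself (vacuously, via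
`lemma121R_untenable`); see `theorem1_of_lemma121`. WHAT THIS IS NOT: a proof of Theorem 1.
[cite: Zhang2022LandauSiegel, §12 Lemma 12.1, p. 68] -/
theorem theorem1_of_lemma121R (h : Skeleton.Lemma121R c') : Theorem1 :=
  theorem1_of_eventually_not_assumptionA (lemma121R_untenable c' h)

end AlphaOneReading

end Literature.NumberTheory.LFunctions.Zhang2022.Typed.Sec12B
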